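/-
Copyright (c) 2026. All rights reserved.
Released under Apache 2.0 license as described in the file LICENSE.
Authors: abc-iut cell, seat abc-iut-w5-d053 (gen 4; rows «COR37-LOGOBS-GLUE» / «COR37-K2-SHIFT», assembly and
the affine sub-model instance) over abc-iut-L4-t5's assembly files.
-/
import Literature.AnabelianGeometry.AbsoluteAnabelian.AbsTopIII.BiAnabelianCompatibilityShiftAssembly
import Literature.AnabelianGeometry.AbsoluteAnabelian.AbsTopIII.BiAnabelianLogGlueShift
import Literature.AnabelianGeometry.AbsoluteAnabelian.AbsTopIII.BiAnabelianLogGlueRestrict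
import Literature.AnabelianGeometry.AbsoluteAnabelian.AbsTopIII.MLFGaloisModelAffineWitnessFull
import HarnessLib

/-!
# [AbsTopIII] Cor 3.7 (iii) second clause and (v) final sentence — what the glued family gives: the (iii)
# collection with its `Φ_m`-compatibility, (v) REDUCED to the shadow family, and the affine sub-model

S. Mochizuki, *Topics in absolute anabelian geometry III* [MochizukiAbsTopIII2015] (kurims manuscript
`paper:url-5493eb38cbb7`), Cor 3.7 (iii) p. 88, (v) p. 88 ("the self-equivalences in these nexus-classes are
compatible with `ℋ_δ` [cf. (ii)], as well as with the families of homotopies that constitute the cores, telecore,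
and observable of (i), (ii), (iii)"; statement of record = abc-iut-L4-t5's successor `ShiftCompatStmt′ θ`,
`BiAnabelianCompatibilityShift.lean`).

PROOF-ONLY one-liners over the chain `BiAnabelianLogGlue*` and abc-iut-L4-t5's assembly
(`BiAnabelianCompatibilityShiftAssembly.lean`; independent of `BiAnabelianLogGlueTelecore.lean`):
* `exists_realisesCoresLogObsTele_shiftCompatible` — the FIRST inner conjunct of `ShiftCompatStmt′ θ`: one family
  (the glued family) realises cores + `𝔖†_log` + telecore `𝒥` AND is `Φ_m`-compatible for every `m`, under (H×),
  (Hlog), over `θ`;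
* `shiftCompatStmt'_of_shadowShift` — `ShiftCompatStmt′ θ` REDUCED to the single remaining input, the
  `Φ_m`-invariance of the canonical shadow family `K'` (abc-iut-L4-t5 gen 7's (R2));
* at the AFFINE SUB-MODEL `𝒳_{P₀}` (`IsAffineModel`, where the lift datum `θ^bi = biAnabelianLiftOfFull` EXISTS,
  `MLFGaloisModelAffineWitnessFull`): BOTH typed halves of (iii), second clause, and the first inner conjunct of
  (v)′, with NO displayed hypothesis (`logObsCompat_isAffineModel`, `…_shiftCompatible_isAffineModel`).
HONEST FRAMING: model-level ≠ node-level; nothing here bears on [IUTchIII] Cor. 3.12; typed ≠ proved elsewhere.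
-/

set_option autoImplicit false

namespace Literature.AnabelianGeometry.AbsoluteAnabelian.AbsTopIII

open CategoryTheory
open Literature.AnabelianGeometry.AbsoluteAnabelian.DiagramOfCategories

universe u

namespace BiAnabelianSetting

variable {X E N : Type u} [Category.{u} X] [Category.{u} E] [Category.{u} N]
  (𝔖 : BiAnabelianSetting X E N) (θ : FiberSquare.BiAnabelianLift 𝔖.gal)
  (hT : ∀ y : X, 𝔖.spaceGal.map (𝔖.iotaTimes.app y) = 𝔖.lamTimesGal.hom.app y ≫ 𝔖.lamTimesPfGal.inv.app y)
  (hL : ∀ A : X, 𝔖.spaceGal.map (𝔖.iotaLog.app A) =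
    𝔖.lamTimesGal.hom.app (𝔖.log.obj A) ≫ 𝔖.logGal.hom.app A ≫ 𝔖.lamTimesPfGal.inv.app A)

include θ hT hL

/-- Both typed halves of Cor 3.7 (iii), second clause, under (H×), (Hlog), over `θ` (abc-iut-L4-t5's
`logObsCompat_of_glueFamily_le` at the glued family; restated here so that this file does not wait for
`BiAnabelianLogGlueTelecore.lean`). [cite: MochizukiAbsTopIII2015, Cor 3.7 (iii) p.88] -/
theorem logObsCompat_of_iotaOverGal' :
    𝔖.LogObsCompatCoresStmt ∧ 𝔖.LogObsCompatTelecoreStmt :=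
  𝔖.logObsCompat_of_glueFamily_le (𝔖.glueLogFamily hT hL)
    (fun _ _ _ _ h => 𝔖.glueFamily_sub_glueLogFamily hT hL h) (𝔖.realisesCoresAndLogObs_glueLogFamily hT hL).1 θ

/-- **Cor 3.7 (v)′, first inner conjunct**: ONE family on `𝒟*` realises the (iii) collection (cores, `𝔖†_log`,
telecore `𝒥`) AND is compatible (Def 3.5 (v)) with every nexus self-equivalence `Φ_m` — the glued family, under
(H×), (Hlog), over `θ`. [cite: MochizukiAbsTopIII2015, Cor 3.7 (v) p.88] -/
theorem exists_realisesCoresLogObsTele_shiftCompatible :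
    ∃ K : 𝔖.starDiagram.HomotopyFamily,
      𝔖.RealisesCoresLogObsTele K ∧ ∀ m : ℤ, Nonempty ((𝔖.shiftEquiv m).hom.CompatibleWith K K) :=
  ⟨𝔖.glueLogFamily hT hL,
    𝔖.realisesCoresLogObsTele_of_glueFamily_le (𝔖.glueLogFamily hT hL)
      (fun _ _ _ _ h => 𝔖.glueFamily_sub_glueLogFamily hT hL h) (𝔖.realisesCoresAndLogObs_glueLogFamily hT hL).1 θ,
    𝔖.compatibleWith_shiftEquiv_glueLogFamily hT hL⟩

/-- **Cor 3.7 (v), final sentence (successor `ShiftCompatStmt′ θ`) REDUCED to the `Φ_m`-invariance of the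
canonical shadow family** `K' = (deltaShadow θ).shadowFamily (deltaFF θ)` realising `𝔗_δ` and `ℋ_δ` (abc-iut-L4-t5's
`realisesTeleDelta_shadowFamily`): everything else is the glued family. [cite: MochizukiAbsTopIII2015, Cor 3.7 (v) p.88] -/
theorem shiftCompatStmt'_of_shadowShift
    (hK'shift : ∀ m : ℤ, Nonempty ((𝔖.shiftEquiv m).hom.CompatibleWith
      ((𝔖.deltaShadow θ).shadowFamily (𝔖.deltaFF θ)) ((𝔖.deltaShadow θ).shadowFamily (𝔖.deltaFF θ)))) :
    𝔖.ShiftCompatStmt' θ :=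
  𝔖.shiftCompatStmt'_of_glueFamily_le θ (𝔖.glueLogFamily hT hL)
    (fun _ _ _ _ h => 𝔖.glueFamily_sub_glueLogFamily hT hL h) (𝔖.realisesCoresAndLogObs_glueLogFamily hT hL).1
    (𝔖.compatibleWith_shiftEquiv_glueLogFamily hT hL) hK'shift

end BiAnabelianSetting

/-! ## At the affine sub-model `𝒳_{P₀}` of the MLF model: no displayed hypothesis -/

namespace TFModel

variable (p : ℕ) [Fact p.Prime]

/-- **[AbsTopIII] Cor 3.7 (iii), second clause — BOTH typed halves — at the affine sub-model `𝒳_{P₀}`**, with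
`θ^bi := biAnabelianLiftOfFull` (NON-VACUOUS: `𝒳_{P₀}` is nonempty and carries the lift datum), and NO displayed
hypothesis ((H×)/(Hlog) are abc-iut-L4-t5's model identities, restricted).
[cite: MochizukiAbsTopIII2015, Cor 3.7 (iii) p.88] -/
theorem logObsCompat_isAffineModel :
    Literature.AnabelianGeometry.AbsoluteAnabelian.AbsTopIII.BiAnabelianSetting.LogObsCompatCoresStmt
        ((modelSetting p).restrict (IsAffineModel (p := p)) fun _ h => h) ∧
      Literature.AnabelianGeometry.AbsoluteAnabelian.AbsTopIII.BiAnabelianSetting.LogObsCompatTelecoreStmt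
        ((modelSetting p).restrict (IsAffineModel (p := p)) fun _ h => h) :=
  ((modelSetting p).restrict (IsAffineModel (p := p)) fun _ h => h).logObsCompat_of_iotaOverGal'
    (biAnabelianLiftOfFull p _ full_galP_isAffineModel)
    ((modelSetting p).restrict_iotaTimes_overGal _ _ (modelSetting_iotaTimes_overGal p))
    ((modelSetting p).restrict_iotaLog_overGal _ _ (modelSetting_iotaLog_overGal p))

/-- **Cor 3.7 (v)′, first inner conjunct, at the affine sub-model `𝒳_{P₀}`**, no displayed hypothesis: one family
realises cores + `𝔖†_log` + `𝒥` and is `Φ_m`-compatible for every `m`. [cite: MochizukiAbsTopIII2015, Cor 3.7 (v) p.88] -/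
theorem exists_realisesCoresLogObsTele_shiftCompatible_isAffineModel :
    ∃ K : ((modelSetting p).restrict (IsAffineModel (p := p)) fun _ h => h).starDiagram.HomotopyFamily,
      ((modelSetting p).restrict (IsAffineModel (p := p)) fun _ h => h).RealisesCoresLogObsTele K ∧
        ∀ m : ℤ, Nonempty ((((modelSetting p).restrict (IsAffineModel (p := p)) fun _ h => h).shiftEquiv m).hom.CompatibleWith K K) :=
  ((modelSetting p).restrict (IsAffineModel (p := p)) fun _ h => h).exists_realisesCoresLogObsTele_shiftCompatible
    (biAnabelianLiftOfFull p _ full_galP_isAffineModel)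
    ((modelSetting p).restrict_iotaTimes_overGal _ _ (modelSetting_iotaTimes_overGal p))
    ((modelSetting p).restrict_iotaLog_overGal _ _ (modelSetting_iotaLog_overGal p))

/-- The same for EVERY sub-model `𝒳_P` at which Prop 3.2 (iv) surjectivity holds (`(P.ι ⋙ gal).Full`, the
hypothesis under which `θ^bi` exists: `biAnabelianLiftOfFull`): both halves of (iii), second clause.
[cite: MochizukiAbsTopIII2015, Cor 3.7 (iii) p.88] -/
theorem logObsCompat_restrict_of_full (P : ObjectProperty (TFModel p)) (hfull : (P.ι ⋙ TFModel.gal p).Full) :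
    Literature.AnabelianGeometry.AbsoluteAnabelian.AbsTopIII.BiAnabelianSetting.LogObsCompatCoresStmt
        ((modelSetting p).restrict P fun _ h => h) ∧
      Literature.AnabelianGeometry.AbsoluteAnabelian.AbsTopIII.BiAnabelianSetting.LogObsCompatTelecoreStmt
        ((modelSetting p).restrict P fun _ h => h) :=
  ((modelSetting p).restrict P fun _ h => h).logObsCompat_of_iotaOverGal' (biAnabelianLiftOfFull p P hfull)
    ((modelSetting p).restrict_iotaTimes_overGal _ _ (modelSetting_iotaTimes_overGal p))
    ((modelSetting p).restrict_iotaLog_overGal _ _ (modelSetting_iotaLog_overGal p))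

end TFModel

end Literature.AnabelianGeometry.AbsoluteAnabelian.AbsTopIII
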